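import Mathlib
import Literature.Geometry.Symplectic.JHolomorphicMap
import Summits.SmoothPoincare4.SmoothPoincare4.Theorems.SullivanDualTameOrBrodyR4StubZalcman
import Summits.SmoothPoincare4.SmoothPoincare4.Theorems.SullivanDualTameOrBrodyR4StubSubseqLocUnif
import Summits.SmoothPoincare4.SmoothPoincare4.Theorems.SullivanDualTameOrBrodyR4StubH1Estimate
import Summits.SmoothPoincare4.SmoothPoincare4.Theorems.SullivanDualTameOrBrodyR4StubLadyzhenskaya
import Summits.SmoothPoincare4.SmoothPoincare4.Theorems.SullivanDualTameOrBrodyR4StubSupBound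
import Summits.SmoothPoincare4.SmoothPoincare4.Theorems.SullivanDualTameOrBrodyR4StubNormIteratedFDerivLe
import Summits.SmoothPoincare4.SmoothPoincare4.Theorems.SullivanDualTameOrBrodyR4StubSmoothLimit
import Summits.SmoothPoincare4.SmoothPoincare4.Theorems.SullivanDualTameOrBrodyR4StubAprioriOf

/-!
# Blow-up data give a bounded entire `J`-curve (line `Sketch`, crux `TameOrBrodyR4`, stmt-SmoothPoincare4-7826, route SullivanDual)

The second half of the composition of the line skeleton `Cruxes/TameOrBrodyR4/Lines/Sketch.lean`
(v7), recorded kernel-checked in the tree: for a `C^∞` almost complex structure `J` on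
`ℝ⁴ = EuclideanSpace ℝ (Fin 4)`, *gradient blow-up data* — a compact `K` and entire `C^∞`
flat-`J`-holomorphic maps `f n : ℂ → ℝ⁴` mapping the closed unit disc into `K` with
`‖d(f n)(0)‖ → ∞` — produce a **bounded non-constant entire `J`-curve**
(`Literature.Geometry.Symplectic.IsBoundedEntireJCurveFlat J u`, verbatim the second disjunct of the
crux). The proof is the classical Zalcman–Brody rescaling followed by compactness under a `C¹`
bound, assembled from the LANDED stubs of the line: `stub_zalcman` (p109847; rescaling of one map to
`‖dg(0)‖ = 1`, `‖dg‖ ≤ 2` on discs of radius `→ ∞`), `stub_subseqLocUnif` (p109831; Arzelà–Ascoli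
with moving discs), the interior a-priori estimate `stub_aprioriOf` (p120441; elliptic bootstrapping
under a `C¹` bound, McDuff–Salamon 2012 Thm B.4.2 for `p = ∞`) fed by the four analytic stubs
`stub_h1Estimate` (p112187), `stub_ladyzhenskaya` (p112170), `stub_supBound` (p112274),
`stub_normIteratedFDerivLe` (p112046), and `stub_smoothLimit` (p112418; smooth limits under locally
uniform bounds on all derivatives). `helper_curveOfBlowup` is the registered helper sub-goal of the
item (arrow form used by the reduction file `SullivanDualTameOrBrodyR4Reduction.lean`).

References: L. Zalcman, *A heuristic principle in complex function theory*, Amer. Math. Monthly 82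
(1975); R. Brody, *Compact manifolds and hyperbolicity*, Trans. AMS 235 (1978); B. Kruglikov,
M. Overholt, *Pseudoholomorphic mappings and Kobayashi hyperbolicity*, Differential Geom. Appl. 11
(1999), Thm 2.2; D. McDuff, D. Salamon, *J-holomorphic curves and symplectic topology*, 2nd ed.
(2012), Thm B.4.2.
-/

-- the registered namespace `Summit.SmoothPoincare4.SmoothPoincare4.…` repeats a component
set_option linter.dupNamespace false

noncomputable section

open scoped ContDiff Topology
open Filter Set Literature.Geometry.Symplectic

namespace Summit.SmoothPoincare4.SmoothPoincare4.Cruxes.TameOrBrodyR4.Sketch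

/-- Local notation for the model space `ℝ⁴ = EuclideanSpace ℝ (Fin 4)`. -/
local notation "E4" => EuclideanSpace ℝ (Fin 4)

namespace BlowUp

/-- **The a-priori estimate** (the lead's reduction `stub_aprioriOf` applied to the four analytic
stubs): `‖D^k g(0)‖ ≤ C(J, R₀, k)` for entire `C^∞` flat-`J`-holomorphic `g` with `‖g‖ ≤ R₀` and
`‖dg‖ ≤ 2` on the closed unit disc. -/
theorem apriori_estimate (J : E4 → E4 →L[ℝ] E4) (hJs : ContDiff ℝ ∞ J)
    (hJ2 : ∀ x v, J x (J x v) = -v) (R₀ : ℝ) (k : ℕ) :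
    ∃ C : ℝ, ∀ (g : ℂ → E4), ContDiff ℝ ∞ g → IsJHolomorphicFlat J g →
      (∀ z : ℂ, ‖z‖ ≤ 1 → ‖g z‖ ≤ R₀) → (∀ z : ℂ, ‖z‖ ≤ 1 → ‖fderiv ℝ g z‖ ≤ 2) →
      ‖iteratedFDeriv ℝ k g 0‖ ≤ C :=
  stub_aprioriOf (fun A₀ hA₀ W hW hWc => stub_h1Estimate A₀ hA₀ W hW hWc) stub_ladyzhenskaya
    (fun W hW hWc z => stub_supBound W hW hWc z) (fun n T => stub_normIteratedFDerivLe n T)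
    J hJs hJ2 R₀ k

/-- Translates of an entire flat-`J`-holomorphic map are flat-`J`-holomorphic. -/
theorem isJHolomorphicFlat_comp_add_left {J : E4 → E4 →L[ℝ] E4} {u : ℂ → E4}
    (huJ : IsJHolomorphicFlat J u) (a : ℂ) : IsJHolomorphicFlat J (fun η => u (a + η)) := by
  intro w ζ
  simp only [fderiv_comp_add_left]
  exact huJ (a + w) ζ

/-- **Compactness under a `C¹` bound (glue).** Entire `C^∞` flat-`J`-holomorphic maps `g n` with
`‖d(g n)‖ ≤ 2` and values in a fixed compact `K` on discs `‖z‖ ≤ r n → ∞` have a subsequence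
converging locally uniformly, together with the first derivatives, to an entire `C^∞`
flat-`J`-holomorphic map (`stub_subseqLocUnif` + `apriori_estimate` at every centre +
`stub_smoothLimit`; the equation passes to the limit pointwise). -/
theorem compactness_C1 (J : E4 → E4 →L[ℝ] E4) (hJs : ContDiff ℝ ∞ J)
    (hJ2 : ∀ x v, J x (J x v) = -v) (K : Set E4) (hK : IsCompact K) (g : ℕ → ℂ → E4)
    (r : ℕ → ℝ) (hr : Tendsto r atTop atTop) (hg : ∀ n, ContDiff ℝ ∞ (g n))
    (hgJ : ∀ n, IsJHolomorphicFlat J (g n)) (hgK : ∀ n (z : ℂ), ‖z‖ ≤ r n → g n z ∈ K)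
    (hgd : ∀ n (z : ℂ), ‖z‖ ≤ r n → ‖fderiv ℝ (g n) z‖ ≤ 2) :
    ∃ (v : ℂ → E4) (φ : ℕ → ℕ), StrictMono φ ∧ ContDiff ℝ ∞ v ∧ IsJHolomorphicFlat J v ∧
      TendstoLocallyUniformly (fun k => g (φ k)) v atTop ∧
      TendstoLocallyUniformly (fun k => fderiv ℝ (g (φ k))) (fderiv ℝ v) atTop := by
  obtain ⟨v, φ, hφ, hloc⟩ := stub_subseqLocUnif K hK g r hr hg hgK hgd
  obtain ⟨R₀, hR₀⟩ := hK.isBounded.exists_norm_le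
  have hrφ : Tendsto (fun k => r (φ k)) atTop atTop := hr.comp hφ.tendsto_atTop
  -- locally uniform bounds on all derivatives of the subsequence
  have hb : ∀ (m : ℕ) (ρ : ℝ), ∃ C : ℝ, ∀ k, ∀ z ∈ Metric.closedBall (0 : ℂ) ρ,
      ‖iteratedFDeriv ℝ m (g (φ k)) z‖ ≤ C := by
    intro m ρ
    obtain ⟨C, hC⟩ := apriori_estimate J hJs hJ2 R₀ m
    obtain ⟨N, hN⟩ := eventually_atTop.mp (tendsto_atTop.mp hrφ (ρ + 1))
    -- tail: translate and apply the a-priori estimate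
    have htail : ∀ k, N ≤ k → ∀ z ∈ Metric.closedBall (0 : ℂ) ρ,
        ‖iteratedFDeriv ℝ m (g (φ k)) z‖ ≤ C := by
      intro k hk z hz
      have hzρ : ‖z‖ ≤ ρ := mem_closedBall_zero_iff.mp hz
      have hmem : ∀ w : ℂ, ‖w‖ ≤ 1 → ‖z + w‖ ≤ r (φ k) := fun w hw =>
        calc ‖z + w‖ ≤ ‖z‖ + ‖w‖ := norm_add_le _ _
          _ ≤ ρ + 1 := add_le_add hzρ hw
          _ ≤ r (φ k) := hN k hk
      have key := hC (fun η => g (φ k) (z + η)) ((hg _).comp (contDiff_const.add contDiff_id))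
        (isJHolomorphicFlat_comp_add_left (hgJ _) z)
        (fun w hw => hR₀ _ (hgK _ _ (hmem w hw)))
        (fun w hw => by
          rw [fderiv_comp_add_left]
          exact hgd _ _ (hmem w hw))
      rw [iteratedFDeriv_comp_add_left, add_zero] at key
      exact key
    -- head: finitely many maps, each bounded on the compact disc by continuity
    have hhead : ∀ k, ∃ B : ℝ, ∀ z ∈ Metric.closedBall (0 : ℂ) ρ,
        ‖iteratedFDeriv ℝ m (g (φ k)) z‖ ≤ B := fun k =>
      (isCompact_closedBall (0 : ℂ) ρ).exists_bound_of_continuousOn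
        ((hg (φ k)).continuous_iteratedFDeriv (by exact_mod_cast le_top)).continuousOn
    choose B hB using hhead
    refine ⟨max C (∑ i ∈ Finset.range N, |B i|), fun k z hz => ?_⟩
    rcases le_or_gt N k with hk | hk
    · exact (htail k hk z hz).trans (le_max_left _ _)
    · calc ‖iteratedFDeriv ℝ m (g (φ k)) z‖ ≤ B k := hB k z hz
        _ ≤ |B k| := le_abs_self _
        _ ≤ ∑ i ∈ Finset.range N, |B i| :=
          Finset.single_le_sum (fun i _ => abs_nonneg (B i)) (Finset.mem_range.mpr hk)
        _ ≤ max C (∑ i ∈ Finset.range N, |B i|) := le_max_right _ _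
  obtain ⟨hv, hd⟩ := stub_smoothLimit (fun k => g (φ k)) v (fun k => hg _) hb hloc
  refine ⟨v, φ, hφ, hv, ?_, hloc, hd⟩
  -- the equation passes to the limit pointwise
  intro z ζ
  have hev : Continuous fun p : (E4 →L[ℝ] E4) × E4 => p.1 p.2 :=
    isBoundedBilinearMap_apply.continuous
  have hTz : Tendsto (fun k => fderiv ℝ (g (φ k)) z) atTop (𝓝 (fderiv ℝ v z)) :=
    hd.tendstoLocallyUniformlyOn.tendsto_at (mem_univ z)
  have huz : Tendsto (fun k => g (φ k) z) atTop (𝓝 (v z)) :=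
    hloc.tendstoLocallyUniformlyOn.tendsto_at (mem_univ z)
  have h1 : Tendsto (fun k => fderiv ℝ (g (φ k)) z (Complex.I * ζ)) atTop
      (𝓝 (fderiv ℝ v z (Complex.I * ζ))) :=
    ((continuous_id.clm_apply continuous_const).tendsto (fderiv ℝ v z)).comp hTz
  have h2 : Tendsto (fun k => J (g (φ k) z) (fderiv ℝ (g (φ k)) z ζ)) atTop
      (𝓝 (J (v z) (fderiv ℝ v z ζ))) := by
    have hJt : Tendsto (fun k => J (g (φ k) z)) atTop (𝓝 (J (v z))) :=
      (hJs.continuous.tendsto (v z)).comp huz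
    have hdζ : Tendsto (fun k => fderiv ℝ (g (φ k)) z ζ) atTop (𝓝 (fderiv ℝ v z ζ)) :=
      ((continuous_id.clm_apply continuous_const).tendsto (fderiv ℝ v z)).comp hTz
    exact (hev.tendsto (J (v z), fderiv ℝ v z ζ)).comp (hJt.prodMk_nhds hdζ)
  have heq : (fun k => fderiv ℝ (g (φ k)) z (Complex.I * ζ)) =
      fun k => J (g (φ k) z) (fderiv ℝ (g (φ k)) z ζ) := funext fun k => hgJ (φ k) z ζ
  rw [heq] at h1
  exact tendsto_nhds_unique h1 h2

/-- **Glue (P5-B ⇒ disjunct 2): blow-up data give a bounded non-constant entire `J`-curve.**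
Discard the finitely many `f n` with `‖d(f n)(0)‖ < 1`, rescale each remaining one by `stub_zalcman`
(`‖dg_n(0)‖ = 1`, `‖dg_n‖ ≤ 2` and `g_n ∈ K` on `‖ζ‖ ≤ M_n/2`, `M_n ≥ ‖d(f n)(0)‖ → ∞`), and apply
`compactness_C1`: the limit `v` is `C^∞`, `J`-holomorphic, takes values in `K` (closed), and
`‖dv(0)‖ = lim ‖dg_n(0)‖ = 1`, so `v` is not constant. -/
theorem curve_of_blowup (J : E4 → E4 →L[ℝ] E4)
    (hJs : ContDiff ℝ ∞ J) (hJ2 : ∀ x v, J x (J x v) = -v) (K : Set E4) (f : ℕ → ℂ → E4)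
    (hK : IsCompact K) (hf : ∀ n, ContDiff ℝ ∞ (f n)) (hfJ : ∀ n, IsJHolomorphicFlat J (f n))
    (hfK : ∀ n (z : ℂ), ‖z‖ ≤ 1 → f n z ∈ K)
    (hblow : Tendsto (fun n => ‖fderiv ℝ (f n) 0‖) atTop atTop) :
    ∃ u : ℂ → E4, IsBoundedEntireJCurveFlat J u := by
  -- discard the head of the sequence: `‖d(f (n + N))(0)‖ ≥ 1`
  obtain ⟨N, hN⟩ := eventually_atTop.mp (tendsto_atTop.mp hblow 1)
  have h0 : ∀ n, fderiv ℝ (f (n + N)) 0 ≠ 0 := fun n h => by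
    have := hN (n + N) (Nat.le_add_left N n)
    rw [h, norm_zero] at this
    exact absurd this (by norm_num)
  -- rescale every remaining map
  choose g M hM hg hgJ hgK hg0 hg2 using fun n =>
    stub_zalcman J K (f (n + N)) (hf _) (hfJ _) (hfK _) (h0 n)
  have hMt : Tendsto M atTop atTop :=
    tendsto_atTop_mono hM ((tendsto_add_atTop_iff_nat N).mpr hblow)
  have hMt2 : Tendsto (fun n => M n / 2) atTop atTop := hMt.atTop_div_const two_pos
  -- a subsequence converging with derivatives to an entire `J`-holomorphic limit
  obtain ⟨v, φ, hφ, hv, hvJ, hloc, hdloc⟩ :=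
    compactness_C1 J hJs hJ2 K hK g (fun n => M n / 2) hMt2 hg hgJ hgK hg2
  refine ⟨v, hv, ?_, ?_, hvJ⟩
  · -- non-constant: `‖dv(0)‖ = 1`
    have h1 : ‖fderiv ℝ v 0‖ = 1 := by
      have ht : Tendsto (fun k => ‖fderiv ℝ (g (φ k)) 0‖) atTop (𝓝 ‖fderiv ℝ v 0‖) :=
        (hdloc.tendstoLocallyUniformlyOn.tendsto_at (mem_univ 0)).norm
      have hc : Tendsto (fun k => ‖fderiv ℝ (g (φ k)) 0‖) atTop (𝓝 1) := by
        simp only [hg0]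
        exact tendsto_const_nhds
      exact tendsto_nhds_unique ht hc
    by_contra! hcon
    have hconst : v = fun _ => v 0 := funext fun z => hcon z 0
    have : fderiv ℝ v 0 = 0 := by rw [hconst]; exact fderiv_const_apply _
    rw [this, norm_zero] at h1
    exact zero_ne_one h1
  · -- bounded: the values lie in the compact `K`
    obtain ⟨B, hB⟩ := hK.isBounded.exists_norm_le
    refine ⟨B, fun z => hB _ ?_⟩
    have hMφ : Tendsto (fun k => M (φ k) / 2) atTop atTop := hMt2.comp hφ.tendsto_atTop
    have hev : ∀ᶠ k in atTop, g (φ k) z ∈ K := by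
      filter_upwards [tendsto_atTop.mp hMφ ‖z‖] with k hk
      exact hgK (φ k) z hk
    exact hK.isClosed.mem_of_tendsto (hloc.tendstoLocallyUniformlyOn.tendsto_at (mem_univ z)) hev

end BlowUp

/-- **Registered helper `helper_curveOfBlowup` (arrow form of `BlowUp.curve_of_blowup`):** blow-up data
for a `C^∞` almost complex structure `J` on `ℝ⁴` give a bounded non-constant entire flat-`J`-holomorphic
curve. -/
theorem helper_curveOfBlowup (J : E4 → E4 →L[ℝ] E4)
    (hJs : ContDiff ℝ ∞ J) (hJ2 : ∀ x v, J x (J x v) = -v) (K : Set E4) (f : ℕ → ℂ → E4)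
    (hK : IsCompact K) (hf : ∀ n, ContDiff ℝ ∞ (f n)) (hfJ : ∀ n, IsJHolomorphicFlat J (f n))
    (hfK : ∀ n (z : ℂ), ‖z‖ ≤ 1 → f n z ∈ K)
    (hblow : Tendsto (fun n => ‖fderiv ℝ (f n) 0‖) atTop atTop) :
    ∃ u : ℂ → E4, IsBoundedEntireJCurveFlat J u :=
  BlowUp.curve_of_blowup J hJs hJ2 K f hK hf hfJ hfK hblow

end Summit.SmoothPoincare4.SmoothPoincare4.Cruxes.TameOrBrodyR4.Sketch
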